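import Summits.BirchSwinnertonDyer.BirchSwinnertonDyer.Theorems.ManinLocalTwoThreeRootSqueezeSeventeenTables
import HarnessLib

/-!
# (S2)₁₇ at level `68`, part 1b: sparse table certificates of the quotients `6–10` and the assembled `hcert68`

Cell `bsd-f2-manin`, route `ManinLocalTwoThree`, cruxes C2/C3 (stmt-BirchSwinnertonDyer-22967/22968); prover seat p3 gen 27; `--supports` (helper).  Pure kernel
arithmetic (one `decide` per quotient — eleven in one declaration exceed the kernel's memory at depth `182`); nothing here proves C2/C3, Manin or BSD.
[cite: Koehler2011, §2.1]
-/

set_option autoImplicit false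
-- lint-debt: the directory name repeats the summit name (sibling precedent `ManinLocalTwoThreeRootSqueezeEleven.lean`)
set_option linter.dupNamespace false

noncomputable section

open Literature.NumberTheory.ModularForms
open Literature.NumberTheory.EllipticCurves Literature.NumberTheory.EllipticCurves.ModularForms

namespace Summit.BirchSwinnertonDyer.BirchSwinnertonDyer.Theorems.ManinLocalTwoThree.RootSqueezeSeventeen

open Summit.BirchSwinnertonDyer.BirchSwinnertonDyer.Theorems.ManinLocalTwoThree.BracketSturm
open Summit.BirchSwinnertonDyer.BirchSwinnertonDyer.Theorems.ManinLocalTwoThree.PinningKernel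

set_option maxHeartbeats 4000000
set_option maxRecDepth 16384

/-- Sparse table certificate of the quotient `6` to depth `182` (kernel `decide`). [cite: Koehler2011, §2.1] -/
theorem hcert68_6 : mulList 182 (tabs68 6) (etaDenListSparse 182 68 (expFn (Ls68[6]).1)) =
    etaNumListSparse 182 68 (expFn (Ls68[6]).1) (shifts68 6) := by
  decide +kernel

/-- Sparse table certificate of the quotient `7` to depth `182` (kernel `decide`). [cite: Koehler2011, §2.1] -/
theorem hcert68_7 : mulList 182 (tabs68 7) (etaDenListSparse 182 68 (expFn (Ls68[7]).1)) =
    etaNumListSparse 182 68 (expFn (Ls68[7]).1) (shifts68 7) := by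
  decide +kernel

/-- Sparse table certificate of the quotient `8` to depth `182` (kernel `decide`). [cite: Koehler2011, §2.1] -/
theorem hcert68_8 : mulList 182 (tabs68 8) (etaDenListSparse 182 68 (expFn (Ls68[8]).1)) =
    etaNumListSparse 182 68 (expFn (Ls68[8]).1) (shifts68 8) := by
  decide +kernel

/-- Sparse table certificate of the quotient `9` to depth `182` (kernel `decide`). [cite: Koehler2011, §2.1] -/
theorem hcert68_9 : mulList 182 (tabs68 9) (etaDenListSparse 182 68 (expFn (Ls68[9]).1)) =
    etaNumListSparse 182 68 (expFn (Ls68[9]).1) (shifts68 9) := by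
  decide +kernel

/-- Sparse table certificate of the quotient `10` to depth `182` (kernel `decide`). [cite: Koehler2011, §2.1] -/
theorem hcert68_10 : mulList 182 (tabs68 10) (etaDenListSparse 182 68 (expFn (Ls68[10]).1)) =
    etaNumListSparse 182 68 (expFn (Ls68[10]).1) (shifts68 10) := by
  decide +kernel

/-- **All eleven table certificates.** [cite: Koehler2011, §2.1] -/
theorem hcert68 : ∀ i : Fin 11, mulList 182 (tabs68 i) (etaDenListSparse 182 68 (expFn (Ls68[(i : ℕ)]).1)) =
    etaNumListSparse 182 68 (expFn (Ls68[(i : ℕ)]).1) (shifts68 i) := by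
  intro i
  fin_cases i
  exacts [hcert68_0, hcert68_1, hcert68_2, hcert68_3, hcert68_4, hcert68_5, hcert68_6, hcert68_7, hcert68_8, hcert68_9, hcert68_10]

end Summit.BirchSwinnertonDyer.BirchSwinnertonDyer.Theorems.ManinLocalTwoThree.RootSqueezeSeventeen

end
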